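import Mathlib.Analysis.SpecificLimits.Normed
import Mathlib.Analysis.SpecialFunctions.Log.Basic
import Mathlib.Analysis.SpecialFunctions.Pow.Real
import Mathlib.Data.Nat.Choose.Bounds

/-!
# Constants of the end-game and separated centres on the torus

Helper for stub `stub_spreadFromPartsR3` (S6′, reshape r3) of line `free-volume-heavy-witness`
(crux `Summit.QuantumFields.QCD.Theses.SpectralDefectExtinction.WindowExtinction`,
item stmt-QuantumFields-8964).  Pure real arithmetic, no project vocabulary.

* `spreadR3_exists_m` — `m` with `2C/√(k+1) ≤ 1/8` for all `k ≥ m`;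
* `spreadR3_exists_N` — `N ≥ m` with `C(N, N-(m-1)) (1-p)^{N-(m-1)} ≤ 1/8` (`0 < p ≤ 1`);
* `spreadR3_exists_D` — `D ≥ 1` with `Z e^{-κ D} ≤ (log 2)/2` (`κ > 0`);
* `spreadR3_exp_two_mul_le_two` — `e^{2τ} ≤ 2` for `τ ≤ (log 2)/2`;
* `spreadR3_centres_separated` — the centres `c_i = (i s, 0, 0, 0)`, `i < N`, are pairwise
  `s`-separated on every torus of side `n ≥ N s` (every periodic image), `s ≥ 1`.
-/

noncomputable section

namespace Summit.QuantumFields.QCD.Cruxes.WindowExtinction.FreeVolumeHeavyWitness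

open Filter Topology

/-- **Choice of `m`.** For every `C` there is `m` with `2C/√(k+1) ≤ 1/8` for all `k ≥ m`. -/
theorem spreadR3_exists_m (C : ℝ) : ∃ m : ℕ, ∀ k : ℕ, m ≤ k → 2 * C / Real.sqrt (k + 1) ≤ 1 / 8 := by
  refine ⟨⌈(16 * C) ^ 2⌉₊, fun k hk => ?_⟩
  have hk1 : (0 : ℝ) < (k : ℝ) + 1 := by positivity
  have hs : 0 < Real.sqrt ((k : ℝ) + 1) := Real.sqrt_pos.2 hk1
  rw [div_le_iff₀ hs]
  have h1 : (16 * C) ^ 2 ≤ (k : ℝ) + 1 := by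
    have := Nat.ceil_le.1 hk
    have h2 : (16 * C) ^ 2 ≤ (⌈(16 * C) ^ 2⌉₊ : ℝ) := Nat.le_ceil _
    have h3 : (⌈(16 * C) ^ 2⌉₊ : ℝ) ≤ k := by exact_mod_cast hk
    linarith
  have h4 : 16 * C ≤ Real.sqrt ((k : ℝ) + 1) := by
    calc 16 * C ≤ |16 * C| := le_abs_self _
      _ = Real.sqrt ((16 * C) ^ 2) := (Real.sqrt_sq_eq_abs _).symm
      _ ≤ Real.sqrt ((k : ℝ) + 1) := Real.sqrt_le_sqrt h1
  linarith

/-- **Choice of `N`.** For `0 < p ≤ 1` and every `m` there is `N ≥ m` with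
`C(N, N-(m-1)) (1-p)^{N-(m-1)} ≤ 1/8`. -/
theorem spreadR3_exists_N :
    ∀ (m : ℕ) {p : ℝ}, 0 < p → p ≤ 1 →
      ∃ N : ℕ, m ≤ N ∧ ((N.choose (N - (m - 1)) : ℝ) * (1 - p) ^ (N - (m - 1))) ≤ 1 / 8 := by
  intro m p hp hp1
  set r : ℝ := 1 - p with hr
  have hr0 : 0 ≤ r := by rw [hr]; linarith
  have hr1 : r < 1 := by rw [hr]; linarith
  rcases hr0.eq_or_lt with hrz | hrpos
  · -- `p = 1`: one inactive box already has probability zero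
    refine ⟨m + 1, Nat.le_succ m, ?_⟩
    have hexp : m + 1 - (m - 1) ≠ 0 := by omega
    rw [← hrz, zero_pow hexp, mul_zero]
    norm_num
  · -- `0 < r < 1`: `N^{m-1} r^N → 0`
    have habs : |r| < 1 := by rw [abs_of_pos hrpos]; exact hr1
    have ht := tendsto_pow_const_mul_const_pow_of_abs_lt_one (m - 1) habs
    have hpos : 0 < r ^ (m - 1) / 8 := by positivity
    obtain ⟨N₀, hN₀⟩ := (ht.eventually (ge_mem_nhds hpos)).exists_forall_of_atTop
    refine ⟨max N₀ m, le_max_right _ _, ?_⟩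
    set N := max N₀ m with hN
    have hmN : m - 1 ≤ N := (Nat.sub_le m 1).trans (le_max_right _ _)
    have hkey : (N : ℝ) ^ (m - 1) * r ^ N ≤ r ^ (m - 1) / 8 := hN₀ N (le_max_left _ _)
    have hchoose : (N.choose (N - (m - 1)) : ℝ) ≤ (N : ℝ) ^ (m - 1) := by
      rw [Nat.choose_symm hmN]
      exact_mod_cast Nat.choose_le_pow N (m - 1)
    have hsplit : r ^ N = r ^ (N - (m - 1)) * r ^ (m - 1) := by
      rw [← pow_add, Nat.sub_add_cancel hmN]
    have hrm : 0 < r ^ (m - 1) := pow_pos hrpos _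
    calc (N.choose (N - (m - 1)) : ℝ) * r ^ (N - (m - 1))
        ≤ (N : ℝ) ^ (m - 1) * r ^ (N - (m - 1)) :=
          mul_le_mul_of_nonneg_right hchoose (pow_nonneg hr0 _)
      _ = (N : ℝ) ^ (m - 1) * r ^ N / r ^ (m - 1) := by
          rw [hsplit, ← mul_assoc, mul_div_assoc, div_self hrm.ne', mul_one]
      _ ≤ r ^ (m - 1) / 8 / r ^ (m - 1) := div_le_div_of_nonneg_right hkey hrm.le
      _ = 1 / 8 := by field_simp

/-- **Choice of `D`.** For `κ > 0` and every `Z` there is `D ≥ 1` with `Z e^{-κ D} ≤ (log 2)/2`. -/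
theorem spreadR3_exists_D {κ : ℝ} (hκ : 0 < κ) (Z : ℝ) :
    ∃ D : ℕ, 1 ≤ D ∧ Z * Real.exp (-(κ * D)) ≤ Real.log 2 / 2 := by
  have hlog : 0 < Real.log 2 := Real.log_pos (by norm_num)
  rcases le_or_gt Z 0 with hZ | hZ
  · refine ⟨1, le_rfl, ?_⟩
    have h2 : 0 < Real.log 2 / 2 := by positivity
    exact le_trans (mul_nonpos_of_nonpos_of_nonneg hZ (Real.exp_pos _).le) h2.le
  · set D : ℕ := max 1 ⌈2 * Z / (κ * Real.log 2)⌉₊ with hD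
    refine ⟨D, le_max_left _ _, ?_⟩
    have hD1 : 2 * Z / (κ * Real.log 2) ≤ D := by
      calc 2 * Z / (κ * Real.log 2) ≤ (⌈2 * Z / (κ * Real.log 2)⌉₊ : ℝ) := Nat.le_ceil _
        _ ≤ D := by exact_mod_cast le_max_right _ _
    have hD1' : (1 : ℝ) ≤ D := by exact_mod_cast le_max_left 1 ⌈2 * Z / (κ * Real.log 2)⌉₊
    have hκD : 0 < κ * D := by positivity
    -- `e^{-κD} ≤ 1/(κ D)`
    have hexp : Real.exp (-(κ * D)) ≤ 1 / (κ * D) := by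
      rw [Real.exp_neg, one_div]
      exact inv_anti₀ hκD (by linarith [Real.add_one_le_exp (κ * D)])
    have hkd : 2 * Z ≤ D * (κ * Real.log 2) := (div_le_iff₀ (mul_pos hκ hlog)).1 hD1
    calc Z * Real.exp (-(κ * D)) ≤ Z * (1 / (κ * D)) := mul_le_mul_of_nonneg_left hexp hZ.le
      _ = Z / (κ * D) := by ring
      _ ≤ Real.log 2 / 2 := by
          rw [div_le_iff₀ hκD]
          nlinarith

/-- `e^{2τ} ≤ 2` for `τ ≤ (log 2)/2`. -/
theorem spreadR3_exp_two_mul_le_two {τ : ℝ} (hτ : τ ≤ Real.log 2 / 2) : Real.exp (2 * τ) ≤ 2 := by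
  calc Real.exp (2 * τ) ≤ Real.exp (Real.log 2) := Real.exp_le_exp.2 (by linarith)
    _ = 2 := Real.exp_log (by norm_num)

/-- **Separated centres.** On the torus of side `n ≥ N s` (`s ≥ 1`) the centres `c_i = (i s, 0, 0, 0)`,
`i < N`, satisfy: for `i ≠ j` and every periodic shift `q`, some coordinate of `c_i - c_j - q n` has
absolute value `≥ s` (the line's `TorusSeparated`, inlined). -/
theorem spreadR3_centres_separated (s N n : ℕ) (hs : 1 ≤ s) (hn : N * s ≤ n) :
    ∀ i j : Fin N, i ≠ j → ∀ q : Fin 4 → ℤ, ∃ k : Fin 4,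
      (s : ℤ) ≤ |(fun k : Fin 4 => if k = 0 then ((i : ℕ) : ℤ) * s else 0) k -
        (fun k : Fin 4 => if k = 0 then ((j : ℕ) : ℤ) * s else 0) k - q k * n| := by
  intro i j hij q
  refine ⟨0, ?_⟩
  simp only [if_true]
  have hi : ((i : ℕ) : ℤ) < N := by exact_mod_cast i.2
  have hj : ((j : ℕ) : ℤ) < N := by exact_mod_cast j.2
  have hi0 : (0 : ℤ) ≤ ((i : ℕ) : ℤ) := by positivity
  have hj0 : (0 : ℤ) ≤ ((j : ℕ) : ℤ) := by positivity
  have hij' : ((i : ℕ) : ℤ) ≠ ((j : ℕ) : ℤ) := by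
    intro h; exact hij (Fin.ext (by exact_mod_cast h))
  have hs' : (1 : ℤ) ≤ s := by exact_mod_cast hs
  have hn' : (N : ℤ) * s ≤ n := by exact_mod_cast hn
  set a : ℤ := ((i : ℕ) : ℤ) - ((j : ℕ) : ℤ) with ha
  have hexpr : ((i : ℕ) : ℤ) * s - ((j : ℕ) : ℤ) * s - q 0 * n = a * s - q 0 * n := by ring
  rw [hexpr]
  have habs_a : |a| ≤ (N : ℤ) - 1 := by rw [abs_le]; constructor <;> omega
  have ha1 : 1 ≤ |a| := Int.one_le_abs (sub_ne_zero.2 hij')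
  by_cases hq : q 0 = 0
  · rw [hq, zero_mul, sub_zero, abs_mul, abs_of_nonneg (by positivity : (0 : ℤ) ≤ s)]
    nlinarith
  · have hq1 : 1 ≤ |q 0| := Int.one_le_abs hq
    have h1 : |q 0 * (n : ℤ)| - |a * s| ≤ |a * s - q 0 * n| := by
      have := abs_sub_abs_le_abs_sub (q 0 * (n : ℤ)) (a * s)
      rwa [abs_sub_comm] at this
    have h2 : (n : ℤ) ≤ |q 0 * (n : ℤ)| := by
      rw [abs_mul, abs_of_nonneg (by positivity : (0 : ℤ) ≤ n)]
      nlinarith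
    have h3 : |a * (s : ℤ)| ≤ ((N : ℤ) - 1) * s := by
      rw [abs_mul, abs_of_nonneg (by positivity : (0 : ℤ) ≤ s)]
      exact mul_le_mul_of_nonneg_right habs_a (by positivity)
    nlinarith

end Summit.QuantumFields.QCD.Cruxes.WindowExtinction.FreeVolumeHeavyWitness

end
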